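import Literature.NumberTheory.LFunctions.DirichletLTruncationPacked
import HarnessLib

/-!
# Packed truncation certificates — soundness of the cell frame

Two frame pieces of the soundness of `LTruncationPacked.certTcells` / `certTframe` (Chua's ALGO 1 on a graded mesh):
(1) the coverage check `covers E (E/2) cells` puts every `σ ∈ [1/2, 1]` in a cell `[i/E, (i+w)/E]`;
(2) the integer cell inequality `cellOK` implies, for `a ≤ 2^P A(s₀)`, `2^P D(s₀) ≤ d`, `loM ≤ 2^P M^{-1/E}`, the real
inequality `B⁻/(2r(M+1)) < A M^{-u} − (w/E) D` for `u ≤ w/E` — the input of `LTruncation.cell_bound` /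
`LTruncationCert.lfunction_ne_zero_of_truncation_drift`. [cite: Chua2005RealZeros, §2.2 ALGO 1]
-/

namespace Literature.NumberTheory.LFunctions

namespace LTruncationPacked

open LTruncationCert

/-! ### Coverage of `[1/2, 1]` by the graded cells -/

/-- The frontier invariant of `covers`: every `y ∈ [cur, E]` lies in some cell, unless `E ≤ cur`. [cite: Chua2005RealZeros, §2.2 ALGO 1] -/
theorem covers_frontier (E : ℕ) : ∀ (cells : List (ℕ × ℕ)) (cur : ℕ), covers E cur cells = true →
    ∀ y : ℝ, (cur : ℝ) ≤ y → y ≤ E → (∃ c ∈ cells, (c.1 : ℝ) ≤ y ∧ y ≤ (c.1 : ℝ) + c.2) ∨ E ≤ cur := by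
  intro cells
  induction cells with
  | nil =>
    intro cur h y _ _
    right; simpa [covers] using h
  | cons c rest ih =>
    intro cur h y hy1 hy2
    obtain ⟨i, w⟩ := c
    simp only [covers, Bool.and_eq_true, Nat.ble_eq] at h
    obtain ⟨hi, hrest⟩ := h
    by_cases hyw : y ≤ (i : ℝ) + w
    · left
      refine ⟨(i, w), by simp, ?_, hyw⟩
      calc (i : ℝ) ≤ cur := by exact_mod_cast hi
        _ ≤ y := hy1
    · have hcur' : ((max cur (i + w) : ℕ) : ℝ) ≤ y := by
        push_cast
        refine max_le hy1 ?_
        exact (not_le.1 hyw).le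
      rcases ih (max cur (i + w)) hrest y hcur' hy2 with ⟨c, hc, h1, h2⟩ | hE
      · left; exact ⟨c, by simp [hc], h1, h2⟩
      · rcases le_max_iff.1 hE with hE1 | hE2
        · right; exact hE1
        · left
          refine ⟨(i, w), by simp, ?_, ?_⟩
          · calc (i : ℝ) ≤ cur := by exact_mod_cast hi
              _ ≤ y := hy1
          · calc y ≤ E := hy2
              _ ≤ (i : ℝ) + w := by exact_mod_cast hE2

/-- **Coverage.** If `covers E (E/2) cells` passes (`E ≥ 1`), every `σ ∈ [1/2, 1]` lies in a cell `[i/E, (i+w)/E]`.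
[cite: Chua2005RealZeros, §2.2 ALGO 1] -/
theorem exists_cell_of_covers {E : ℕ} (hE : 1 ≤ E) {cells : List (ℕ × ℕ)} (h : covers E (E / 2) cells = true)
    {σ : ℝ} (h1 : 1 / 2 ≤ σ) (h2 : σ ≤ 1) :
    ∃ c ∈ cells, (c.1 : ℝ) ≤ σ * E ∧ σ * E ≤ (c.1 : ℝ) + c.2 := by
  have hE0 : (0 : ℝ) < E := by exact_mod_cast hE
  have hy1 : ((E / 2 : ℕ) : ℝ) ≤ σ * E := by
    calc ((E / 2 : ℕ) : ℝ) ≤ (E : ℝ) / 2 := by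
          have := Nat.cast_div_le (m := E) (n := 2) (α := ℝ); simpa using this
      _ ≤ σ * E := by nlinarith
  have hy2 : σ * E ≤ E := by nlinarith
  rcases covers_frontier E cells (E / 2) h (σ * E) hy1 hy2 with h | hbad
  · exact h
  · omega

/-! ### The cell inequality in real form -/

/-- Floor division of a power by a power of two only decreases the real quotient: `⌊l^w / 2^{P(w−1)}⌋ ≤ l^w / 2^{P(w−1)}`. [folklore] -/
private theorem rho_le (loM P w : ℕ) :
    (((loM ^ w / 2 ^ (P * (w - 1)) : ℕ) : ℕ) : ℝ) ≤ (loM : ℝ) ^ w / (2 : ℝ) ^ (P * (w - 1)) := by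
  have := Nat.cast_div_le (m := loM ^ w) (n := 2 ^ (P * (w - 1))) (α := ℝ)
  simpa using this

/-- `ρ_w = ⌊loM^w / 2^{P(w−1)}⌋ ≤ 2^P · M^{−w/E}` when `loM ≤ 2^P M^{−1/E}`. [cite: Chua2005RealZeros, §2.2 ALGO 1] -/
theorem rho_le_rpow {M E P loM w : ℕ} (hM : 1 ≤ M) (hw : 1 ≤ w)
    (hlo : (loM : ℝ) ≤ (2 : ℝ) ^ P * (M : ℝ) ^ (-(1 / (E : ℝ)))) :
    (((loM ^ w / 2 ^ (P * (w - 1)) : ℕ) : ℕ) : ℝ) ≤ (2 : ℝ) ^ P * (M : ℝ) ^ (-((w : ℝ) / E)) := by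
  have hM0 : (0 : ℝ) < M := by exact_mod_cast hM
  refine (rho_le loM P w).trans ?_
  rw [div_le_iff₀ (by positivity)]
  have h1 : (loM : ℝ) ^ w ≤ ((2 : ℝ) ^ P * (M : ℝ) ^ (-(1 / (E : ℝ)))) ^ w :=
    pow_le_pow_left₀ (Nat.cast_nonneg _) hlo w
  have h2 : ((2 : ℝ) ^ P * (M : ℝ) ^ (-(1 / (E : ℝ)))) ^ w =
      (2 : ℝ) ^ P * (M : ℝ) ^ (-((w : ℝ) / E)) * (2 : ℝ) ^ (P * (w - 1)) := by
    rw [mul_pow, ← Real.rpow_natCast ((M : ℝ) ^ _) w, ← Real.rpow_mul hM0.le]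
    obtain ⟨v, rfl⟩ : ∃ v, w = v + 1 := ⟨w - 1, by omega⟩
    rw [show ((2 : ℝ) ^ P) ^ (v + 1) = (2 : ℝ) ^ P * (2 : ℝ) ^ (P * (v + 1 - 1)) by
      rw [← pow_mul, ← pow_add, Nat.add_sub_cancel]; ring_nf]
    rw [show -(1 / (E : ℝ)) * ((v + 1 : ℕ) : ℕ) = -(((v + 1 : ℕ) : ℝ) / E) by ring]
    ring
  rw [h2] at h1
  exact h1

/-- **The cell inequality.** If `cellOK P E M r Bm loM (i, w) (a, d)` passes, `a ≤ 2^P A`, `2^P D ≤ d` (`D ≥ 0`), and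
`loM ≤ 2^P M^{-1/E}` (`M ≥ 1`), then for every `u ≤ w/E`:
`Bm/(2r(M+1)) < A·M^{-u} − (w/E)·D`, and `0 ≤ A`. [cite: Chua2005RealZeros, §2.2 ALGO 1] -/
theorem cellOK_sound {P E M r Bm loM i w : ℕ} {a : ℤ} {d : ℕ} (hE : 1 ≤ E) (hM : 1 ≤ M)
    (h : cellOK P E M r Bm loM (i, w) (a, d) = true) {A D : ℝ} (ha : (a : ℝ) ≤ (2 : ℝ) ^ P * A)
    (hd : (2 : ℝ) ^ P * D ≤ d)
    (hlo : (loM : ℝ) ≤ (2 : ℝ) ^ P * (M : ℝ) ^ (-(1 / (E : ℝ)))) {u : ℝ} (huw : u ≤ (w : ℝ) / E) :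
    0 ≤ A ∧ (Bm : ℝ) / (2 * r * (M + 1 : ℕ)) < A * (M : ℝ) ^ (-u) - (w : ℝ) / E * D := by
  simp only [cellOK, Bool.and_eq_true, decide_eq_true_eq, Nat.ble_eq, Nat.blt_eq] at h
  obtain ⟨⟨ha0, hw⟩, hineq⟩ := h
  have hM0 : (0 : ℝ) < M := by exact_mod_cast hM
  have hE0 : (0 : ℝ) < E := by exact_mod_cast hE
  have h2P : (0 : ℝ) < 2 ^ P := by positivity
  have ha0' : (0 : ℝ) ≤ a := by exact_mod_cast ha0
  have hA0 : 0 ≤ A := by nlinarith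
  refine ⟨hA0, ?_⟩
  set ρ : ℕ := loM ^ w / 2 ^ (P * (w - 1)) with hρ
  set qu : ℝ := (M : ℝ) ^ (-u) with hqu
  have hρle : (ρ : ℝ) ≤ (2 : ℝ) ^ P * qu := by
    refine (rho_le_rpow hM hw hlo).trans (mul_le_mul_of_nonneg_left ?_ h2P.le)
    rw [hqu]
    exact Real.rpow_le_rpow_of_exponent_le (by exact_mod_cast hM) (neg_le_neg huw)
  have hqu0 : 0 ≤ qu := (Real.rpow_pos_of_pos hM0 _).le
  -- the truncated subtraction is a genuine one (the left side is positive or `Bm = 0`… in all cases `<` forces it)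
  have hsub : w * d * 2 ^ P < E * a.toNat * ρ := by
    by_contra hle
    rw [Nat.sub_eq_zero_of_le (not_lt.1 hle), mul_zero] at hineq
    exact absurd hineq (Nat.not_lt_zero _)
  have hcast : ((a.toNat : ℕ) : ℝ) = (a : ℝ) := by
    have : ((a.toNat : ℕ) : ℤ) = a := Int.toNat_of_nonneg ha0
    exact_mod_cast this
  have hineqR : (E : ℝ) * 2 ^ P * 2 ^ P * Bm < 2 * r * (M + 1) * ((E : ℝ) * a * ρ - (w : ℝ) * d * 2 ^ P) := by
    have h1 : ((E * 2 ^ P * 2 ^ P * Bm : ℕ) : ℝ) < ((2 * r * (M + 1) * (E * a.toNat * ρ - w * d * 2 ^ P) : ℕ) : ℝ) := by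
      exact_mod_cast hineq
    push_cast [Nat.cast_sub hsub.le] at h1
    rw [hcast] at h1
    exact h1
  -- replace `a ρ` by `2^P A · 2^P qu` and `d` by `2^P D`
  have h5 : (a : ℝ) * ρ ≤ (2 : ℝ) ^ P * A * ((2 : ℝ) ^ P * qu) :=
    mul_le_mul ha hρle (Nat.cast_nonneg _) (by positivity)
  have hr0 : (0 : ℝ) ≤ r := Nat.cast_nonneg _
  have hmain : (E : ℝ) * 2 ^ P * 2 ^ P * Bm <
      2 * r * (M + 1) * ((E : ℝ) * ((2 : ℝ) ^ P * A * ((2 : ℝ) ^ P * qu)) - (w : ℝ) * ((2 : ℝ) ^ P * D) * 2 ^ P) := by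
    refine hineqR.trans_le ?_
    refine mul_le_mul_of_nonneg_left ?_ (by positivity)
    have h6 : (E : ℝ) * a * ρ ≤ (E : ℝ) * ((2 : ℝ) ^ P * A * ((2 : ℝ) ^ P * qu)) := by
      rw [mul_assoc]; exact mul_le_mul_of_nonneg_left h5 hE0.le
    have h7 : (w : ℝ) * ((2 : ℝ) ^ P * D) * 2 ^ P ≤ (w : ℝ) * d * 2 ^ P := by
      refine mul_le_mul_of_nonneg_right (mul_le_mul_of_nonneg_left hd (Nat.cast_nonneg _)) h2P.le
    linarith
  -- divide by `E 4^P` and by `2 r (M+1)`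
  by_cases hr : r = 0
  · subst hr; simp at hmain
    have : (0 : ℝ) ≤ (E : ℝ) * 2 ^ P * 2 ^ P * Bm := by positivity
    linarith
  have hr' : (0 : ℝ) < r := by exact_mod_cast Nat.pos_of_ne_zero hr
  have hK : (0 : ℝ) < 2 * r * (M + 1 : ℕ) := by positivity
  rw [div_lt_iff₀ hK]
  have : (E : ℝ) * 2 ^ P * 2 ^ P * (Bm : ℝ) <
      (E : ℝ) * 2 ^ P * 2 ^ P * ((A * qu - (w : ℝ) / E * D) * (2 * r * (M + 1 : ℕ))) := by
    refine hmain.trans_le (le_of_eq ?_)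
    push_cast
    field_simp
  exact lt_of_mul_lt_mul_left this (by positivity)

end LTruncationPacked

end Literature.NumberTheory.LFunctions
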